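import Summits.QuantumFields.YangMills.Theorems.UnitScaleTiltHalvingCompetitorMapFrames
import Summits.QuantumFields.YangMills.Theorems.BalabanUVNodesK0Stub1FlatAveragingDictionaryLevels
import HarnessLib

/-!
# K0⁷ STUB 1 (`stub_prop8StepCoP13`), sub-target S4a — **THE MULTI-LEVEL NONLINEAR ♭ → SINGLE-BAR FIBRE DICTIONARY**: two fine fields with EQUAL DOUBLE-BAR DATA on the
# [B6] (2.3) index bonds of a nested family differ, on the SINGLE-bar data of EVERY level at once, by ONE FINE GAUGE TRANSFORMATION (the quotient of the accumulated
# block frames read at the touched block centres) — [Balaban1985Averaging] (92)∕(97)∕(99) for NODE 00's MULTI-LEVEL fibre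

Cell `pub-ymgap`, width seat `pub-ymgap-k0-s1-w1` g7 (CLAIM-1; the located on-path item of HOME `HANDOFF.md` § g6: the ♭-road socket PRODUCER's configuration-level
core — dag-n07-w1 g6 (t2) «currently unowned»).  `--kind proof --supports stmt-QuantumFields-20541 --as helper`; count-neutral.  [15] = [Balaban1985Variational];
[B7AVG] = [Balaban1985Averaging]; [B6] = [Balaban1984PropagatorsII]; [I] = [Balaban1987RG1].

WHY.  On the (R1′) ♭ road (k0-s1-w2∕w4: `…FlatChartKernel157P` p627481, `…FlatChartTheta0AtRecord` p628026, `…FlatChartDImplicit` p629502) Sect. F's chart (47) is built on the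
DOUBLE-bar functional `chartLogFlat` ([B7AVG] (89): `U̿ = v(c₋)⁻¹·Ū(c)·v(c₊)`, iterated with recomputed frames), whose linearisation at `1` is the STRAIGHT block average — so
the heart's kernel is print's and the corrected current of this seat's g5∕g6 files is `T = 0`.  The price is paid at the configuration level: NODE 00's record is critical on the
MULTI-LEVEL SINGLE-bar fibre `{U | Ū^{(j)}U = W_j on Λ_j, every j}` ([15] (5)–(6), [III] (2.10)–(2.12); `Node00.IsCritOnFibre`), while the charted competitors
`e^{iη·chart♭(A′₁ + tδ)}` have constant DOUBLE-bar data.  [B7AVG] (92)∕(97)∕(99) (UST ✓`Prop8ChartDoubleBar.dbarIterU_eq_gaugeActT_emlIterU`): `U̿^{(j)} = (Ū^{(j)})^{V_j⁻¹}`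
with the ACCUMULATED frames `V_j` (97); hence equal ♭-data give single-bar data that differ, AT EACH LEVEL, by the coarse gauge `V_j(U₁)·V_j(W)⁻¹`.  The `ym3-torus` cell typed
this for its ONE-LEVEL top fibre `𝔅_k(V)` (✓`HalvingCompetitorMapTower`∕`…Frames`, a COARSE gauge on `T^{(k)}`).  NODE 00's fibre pins ALL levels, so ONE FINE gauge map
`g : T_η → 𝔸ˣ` must realise `V_j(U₁)(y)·V_j(W)(y)⁻¹` at the centre `embIter j y` of EVERY touched block of EVERY level simultaneously — and centres of different levels
COLLIDE.  Under the collar clause of [B6] (2.2) (UST `collar_of_adm22`) a collision of two touched centres is `(j, emb y′)`-vs-`(j+1, y′)` with `y′ ∉ Ω_{j+1}` (this seat's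
p616754 depth trichotomy), and there the two prescriptions AGREE: `V_{j+1}(y′) = V_j(emb y′)·v(U̿^{(j)})(y′)` and the level-`j` block frame at `y′` reads only non-deep bonds, on
which the two double-bar fields coincide (✓tower pinning `HalvingCompetitorMapTower.dbarIterU_eq_of_index_eq`, ✓`HalvingCompetitorMapFrames.vframeU_dbarIterU_eq_of_not_mem_Om`).
This is the NONLINEAR twin of this seat's linear multi-level dictionary p617458 `exists_linear_gauge_dIterL_one_eq_zero_of_bondAvgIter_eq_zero` (whose `T` is the
linearisation of `g` at `1`, and vanishes on the ♭ road exactly because `g` exists at the nonlinear level).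

WHAT IS PROVED (sorry-free; no definition; axioms standard; generic `P : Params`, generic complete normed ℂ-algebra `𝔸`, fields `GaugeField P 0 𝔸ˣ`).
* §0 geometry of [B6] (2.3) under the collar: ★ `collision_level` (two touched sites of levels `j < j′` with one centre ⇒ `j′ = j + 1` and `y′ ∉ Ω_{j′}`),
  `eq_emb_of_embIter_eq` (then `y = emb y′`).
* §1 ★ `emlIterU_gaugeActT_fine` (covariance (11) for a FINE gauge map read at the block centres: `Ū^{(j)}(W^{g}) = (Ū^{(j)}W)^{g ∘ embIter j}`), `emlIterU_eq_gaugeActT_accFrames`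
  (`Ū^{(j)} = (U̿^{(j)})^{V_j}`), ★★ `emlIterU_gaugeActT_eq_of_accFrames` — NO collar: ANY fine `g` with `g(embIter j y) = V_j(U₁)(y)·V_j(W)(y)⁻¹` at the end-points of the index
  bonds gives `Ū^{(j)}(W^{g})(c) = Ū^{(j)}(U₁)(c)` at every index bond `c` of every level `j ≤ k`.
* §2 ★★ `accFrames_quotient_eq_of_collision` (collar): the prescription is CONSISTENT at colliding centres.
* §3 ★★★ `exists_fineGauge_family` — for a FAMILY `W t` (`t : ι`) of fields with the ♭-data of `U₁` and given accumulated frames: ONE family `g t` of fine gauge maps with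
  `Ū^{(j)}((W t)^{g t})(c) = Ū^{(j)}(U₁)(c)` at every index bond of every level, AND the uniform-choice clause «at every fine site `x`, either `g t x = 1` for all `t`, or
  `g t x = V_j(U₁)(y)·V_j(W t)(y)⁻¹` for all `t` at ONE touched `(j, y)` with `embIter j y = x`» (what the differentiability of `t ↦ g t` along a charted curve reads);
  ★★★ `exists_fineGauge_emlIterU_eq_of_dbarIterU_eq` (one field).
* §4 ★★ `exists_fineGauge_pred_family` ∕ `exists_fineGauge_pred_emlIterU_eq` — the same with `g t x` in ANY multiplicative inverse-closed predicate `p` («unitary, det = 1» at the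
  knit) under UST's small-readable-blocks hypotheses (✓`accFrames_quotient_pred`).
* §5 ★ `exists_fineGauge_emlIterU_eq_of_dbarIterU_eq_gaugeActT` — target a gauge copy `U₁ = (U₀)^{u}`: some fine `g` gives `Ū^{(j)}((W t)^{g t}) = Ū^{(j)}(U₀)` on the index bonds.

HONEST SCOPE.  Finite group∕lattice algebra over kernel-checked UST identities and this seat's p616754 geometry; NO estimate, NO smallness, NO chart, NO `SU(N)`∕`avOfRecord`
reading (n07-w2 g3's local dictionary `emlIterU_unitsField_eq_iter_of_reads` is the next brick), NO derivative; the SOCKET `h127rec` is NOT produced here; nothing of Bałaban's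
analysis asserted; `stub_prop8StepCoP13` ∕ K0⁷ NOT closed; N07 NOT discharged; counts unmoved (28∕28 · 5∕27); one finite 𝕋⁴ programme at fixed ε — R4 closes the conditional
finite-𝕋⁴ rung `BalabanLadder.UV` only, never the summit; the YM mass gap (Clay) is NOT proved by any of this; nothing continuum ∕ ℝ⁴ ∕ OS.  No `sorry`, no `def`, no `instance`,
no `notation`.

References: [B7AVG] T. Bałaban, CMP **98** (1985) 17–51 ((11) p.19, (89) p.31, (92) p.31, (97)–(100) p.32, (110) p.34); [B6] CMP **96** (1984) 223–250 ((2.1)–(2.4) p.224);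
[15] CMP **102** (1985) 277–309 ((5)–(6) p.278, (20) p.281, (44)–(49) p.285, (150) p.301, (156)–(158) p.302); [I] CMP **109** (1987) 249–301 ((0.1) p.251, (0.4), (0.11) p.253);
[III] CMP **119** (1988) 243–285 ((2.10)–(2.12) p.256).
-/

set_option autoImplicit false

noncomputable section

namespace Summit.QuantumFields.YangMills.Theorems.K0Stub1DoubleBarFibreDictionary

open Literature.MathematicalPhysics.QuantumFieldTheory.Balaban1983to89
open T4Continuum BlockAveraging
open B10Eq27TorusAxialLog (gaugeActT gaugeActT_apply)
open B5Eq118OneStroke (iterBlockOf iterBlockOf_zero iterBlockOf_succ)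
open B15DeterminingSets (embIter)
open B6SectADomainsV1 (Domains)
open B6SectAOperatorsV1 (BondIdx)
open Summit.QuantumFields.YangMills.Theorems.Prop8Chart (emlIterU emlIterU_gaugeActT)
open Summit.QuantumFields.YangMills.Theorems.Prop8ChartDoubleBar (vframeU dbarIterU dbarIterU_eq_gaugeActT_emlIterU exists_accFrames_dbarIterU gaugeActT_gaugeActT
  gaugeActT_const_one)
open Summit.QuantumFields.YangMills.Theorems.HalvingCompetitorMapFrames (vframeU_dbarIterU_eq_of_not_mem_Om accFrames_quotient_pred)
open Summit.QuantumFields.YangMills.Theorems.K0Stub1TouchedCentresOfDomains (embIter_injective iterBlockOf_embIter_eq_emb blockOf_emb_shift blockOf_eq_of_shift_eq_emb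
  inOm_of_le_depth not_inOm_of_depth_lt depth_cases_of_touched)
open Summit.QuantumFields.YangMills.Theorems.K0Stub1FlatAveragingDictionaryLevels (lamSite_or_of_lamBond)

variable {P : Params}

/-! ## §0  Geometry of the (2.3) index bonds under the collar: colliding touched centres -/

section Geometry

variable (D : Domains P)
  (hcollar : ∀ (i : ℕ) (e : PBond P (i + 1)), D.LamBond (i + 1) e → ∀ z : Site P i, (blockOf z = e.src ∨ blockOf z = e.tgt) → z ∈ D.Om i)

/-- If a `j`-site and a `(j+1)`-site have the same centre, the former is the central sub-site of the latter (`embIter (j+1) y′ = embIter j (emb y′)` definitionally —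
UST `Prop7TrueLinPureGaugeIter.embIter_succ` — and `embIter j` is injective). [cite: Balaban1987RG1, (0.1) p.251] -/
theorem eq_emb_of_embIter_eq {j : ℕ} (hj : j ≤ P.m + P.K) {y : Site P j} {y' : Site P (j + 1)} (heq : embIter j y = embIter (j + 1) y') : y = emb y' :=
  embIter_injective hj (heq.trans (rfl : embIter (j + 1) y' = embIter j (emb y')))

include hcollar in
/-- ★ **COLLIDING TOUCHED CENTRES, LEVEL NORMAL FORM** (collar): if an end-point `y` of a (2.3) index bond of level `j` and an end-point `y′` of a (2.3) index bond of level
`j′ > j` have the SAME centre, then `j′ = j + 1` and `y′ ∉ Ω_{j′}^{(j′)}` (an OUTER-boundary site) — the castless normal form inside this seat's p616754 `comb_eq_of_collision`: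
depth trichotomy at both levels; an inner-crossing `y`, central in its `(j+1)`-block, would have only deep neighbours; an outer `y` has nothing touched above it.
[cite: Balaban1984PropagatorsII, (2.1)-(2.4) p.224; Balaban1987RG1, (0.1) p.251] -/
theorem collision_level {j j' : ℕ} {b : PBond P j} {b' : PBond P j'} (hb : D.LamBond j b) (hb' : D.LamBond j' b') {y : Site P j} {y' : Site P j'}
    (hyb : y = b.src ∨ y = b.tgt) (hyb' : y' = b'.src ∨ y' = b'.tgt) (hlt : j < j') (heq : embIter j y = embIter j' y') :
    j' = j + 1 ∧ y' ∉ D.Om j' := by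
  have hI₁ : ∀ (i : ℕ) (e : PBond P i), D.LamBond i e → D.LamSite i e.src ∨ D.LamSite i e.tgt := fun i e he => lamSite_or_of_lamBond D he
  have hjk' : j' ≤ D.k := by rcases hI₁ j' b' hb' with h | h <;> exact D.le_of_lamSite h
  have hj'P : j' ≤ P.m + P.K := hjk'.trans D.hk
  have hjP : j ≤ P.m + P.K := by omega
  obtain ⟨x, hx⟩ : ∃ x : Site P 0, embIter j' y' = x := ⟨_, rfl⟩
  have hyx : iterBlockOf j x = y := by rw [← hx, ← heq, Node00.iterBlockOf_embIter j hjP]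
  have hy'x : iterBlockOf j' x = y' := by rw [← hx, Node00.iterBlockOf_embIter j' hj'P]
  obtain ⟨j₀, -, hj₀⟩ := D.exists_lamSite_iterBlockOf x
  have hc := depth_cases_of_touched D hcollar hI₁ hb (x := x) (by rw [hyx]; exact hyb) hj₀
  have hc' := depth_cases_of_touched D hcollar hI₁ hb' (x := x) (by rw [hy'x]; exact hyb') hj₀
  rcases hc with h₀ | ⟨h₀, -, -⟩ | ⟨h₀, y₁, μ, hy₁, hadj⟩
  · -- `y` is the Λ_j-site of `x`: `y′` must be the outer-boundary case at level `j + 1`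
    rcases hc' with h₀' | ⟨h₀', hout', -⟩ | ⟨h₀', -⟩
    · omega
    · exact ⟨by omega, hy'x ▸ hout'⟩
    · omega
  · -- `y` outer at level `j = j₀ + 1`: nothing touched strictly above
    rcases hc' with h₀' | ⟨h₀', -⟩ | ⟨h₀', -⟩ <;> omega
  · -- `y` inner-crossing (deep) with a non-deep neighbour `y₁`, yet central in its `(j+1)`-block: contradiction
    exfalso
    have hyemb : y = emb (iterBlockOf (j + 1) x) := by rw [← hyx, ← hx]; exact iterBlockOf_embIter_eq_emb hlt hj'P y'
    have hj1P : j + 1 ≤ P.m + P.K := by omega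
    have hblk₁ : blockOf y₁ = iterBlockOf (j + 1) x := by
      rcases hadj with h | h
      · rw [h, hyx, hyemb]; exact blockOf_emb_shift hj1P _ μ
      · exact blockOf_eq_of_shift_eq_emb hj1P (by rw [h, hyx, hyemb])
    have hdeep : D.InOm (j + 1) x := inOm_of_le_depth D hj₀ h₀
    exact hy₁ (by unfold Domains.Deep; rw [hblk₁]; exact hdeep)

end Geometry

variable {𝔸 : Type*} [NormedRing 𝔸] [NormedAlgebra ℂ 𝔸] [CompleteSpace 𝔸]

/-! ## §1  The single-bar data of a fine gauge copy, through the accumulated frames (no collar) -/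

section Frames

variable (D : Domains P)

/-- ★ **COVARIANCE (11) FOR A FINE GAUGE MAP READ AT THE BLOCK CENTRES**: `Ū^{(j)}(W^{g}) = (Ū^{(j)}W)^{g ∘ embIter j}` — UST ✓`emlIterU_gaugeActT` with the block-centre
tower `i ↦ g ∘ embIter i`, whose recursion `g(embIter (i+1) y) = g(embIter i (emb y))` is definitional. [cite: Balaban1985Averaging, (11) p.19; Balaban1987RG1, (0.1) p.251, (0.11) p.253] -/
theorem emlIterU_gaugeActT_fine (g : GaugeTransf P 0 𝔸ˣ) (W : GaugeField P 0 𝔸ˣ) (j : ℕ) :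
    emlIterU j (gaugeActT g W) = gaugeActT (fun y : Site P j => g (embIter j y)) (emlIterU j W) :=
  emlIterU_gaugeActT (fun i (y : Site P i) => g (embIter i y)) (fun _ _ => rfl) W j

/-- **`Ū^{(j)} = (U̿^{(j)})^{V_j}`**: (92) read from the single-bar side — the single-bar iterate is the double-bar iterate gauge-transformed by the accumulated frames.
[cite: Balaban1985Averaging, (92) p.31, (97)-(100) p.32] -/
theorem emlIterU_eq_gaugeActT_accFrames (W : GaugeField P 0 𝔸ˣ) (V : (j : ℕ) → Site P j → 𝔸ˣ) (hV0 : ∀ x, V 0 x = 1)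
    (hVs : ∀ (j : ℕ) (y : Site P (j + 1)), V (j + 1) y = V j (emb y) * vframeU (dbarIterU j W) y) (j : ℕ) :
    emlIterU j W = gaugeActT (V j) (dbarIterU j W) := by
  rw [dbarIterU_eq_gaugeActT_emlIterU W V hV0 hVs j, gaugeActT_gaugeActT]
  have h1 : (fun y : Site P j => V j y * (V j y)⁻¹) = fun _ => 1 := funext fun y => mul_inv_cancel _
  rw [h1, gaugeActT_const_one]

/-- ★★ **THE SINGLE-BAR DATA OF A FINE GAUGE COPY** (no collar): `W`, `U₁` with equal double-bar data on the index bonds, `V`, `V₁` their accumulated frames (97); then for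
ANY fine gauge map `g` with `g(embIter j y) = V₁_j(y)·V_j(y)⁻¹` at the end-points `y` of the index bonds of every level `j ≤ k`, `Ū^{(j)}(W^{g})(c) = Ū^{(j)}(U₁)(c)` at every
index bond `c` of every level `j ≤ k` — (11) ∘ (92): `Ū^{(j)}(W^{g})(c) = g_j(c₋)V_j(c₋)·U̿^{(j)}W(c)·(g_j(c₊)V_j(c₊))⁻¹ = V₁_j(c₋)·U̿^{(j)}U₁(c)·V₁_j(c₊)⁻¹`.
[cite: Balaban1985Averaging, (11) p.19, (92) p.31, (97)-(100) p.32; Balaban1984PropagatorsII, (2.3) p.224] -/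
theorem emlIterU_gaugeActT_eq_of_accFrames {W U₁ : GaugeField P 0 𝔸ˣ}
    (hidx : ∀ idx : BondIdx D, dbarIterU (idx.1.1 : ℕ) W idx.1.2 = dbarIterU (idx.1.1 : ℕ) U₁ idx.1.2)
    (V : (j : ℕ) → Site P j → 𝔸ˣ) (hV0 : ∀ x, V 0 x = 1) (hVs : ∀ (j : ℕ) (y : Site P (j + 1)), V (j + 1) y = V j (emb y) * vframeU (dbarIterU j W) y)
    (V₁ : (j : ℕ) → Site P j → 𝔸ˣ) (hV₁0 : ∀ x, V₁ 0 x = 1) (hV₁s : ∀ (j : ℕ) (y : Site P (j + 1)), V₁ (j + 1) y = V₁ j (emb y) * vframeU (dbarIterU j U₁) y)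
    (g : GaugeTransf P 0 𝔸ˣ)
    (hg : ∀ (j : ℕ) (c : PBond P j), j ≤ D.k → D.LamBond j c → ∀ y : Site P j, (y = c.src ∨ y = c.tgt) → g (embIter j y) = V₁ j y * (V j y)⁻¹) :
    ∀ (j : ℕ) (c : PBond P j), j ≤ D.k → D.LamBond j c → emlIterU j (gaugeActT g W) c = emlIterU j U₁ c := by
  intro j c hj hc
  have hd : dbarIterU j W c = dbarIterU j U₁ c := hidx ⟨⟨⟨j, Nat.lt_succ_of_le hj⟩, c⟩, hc⟩
  rw [emlIterU_gaugeActT_fine, gaugeActT_apply, emlIterU_eq_gaugeActT_accFrames W V hV0 hVs j, emlIterU_eq_gaugeActT_accFrames U₁ V₁ hV₁0 hV₁s j,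
    gaugeActT_apply, gaugeActT_apply, hd, hg j c hj hc c.src (Or.inl rfl), hg j c hj hc c.tgt (Or.inr rfl)]
  simp only [mul_inv_rev, inv_inv, mul_assoc, inv_mul_cancel_left]

end Frames

/-! ## §2  Consistency of the frame quotient at colliding centres (collar) -/

section Consistency

variable (D : Domains P)
  (hcollar : ∀ (i : ℕ) (e : PBond P (i + 1)), D.LamBond (i + 1) e → ∀ z : Site P i, (blockOf z = e.src ∨ blockOf z = e.tgt) → z ∈ D.Om i)

/-- One (2.3)-touched step up: at a `(j+1)`-site `y′ ∉ Ω_{j+1}` the frame quotient of level `j + 1` equals that of level `j` at `emb y′` — the two level-`j` block frames at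
`y′` coincide (UST ✓`vframeU_dbarIterU_eq_of_not_mem_Om`: they read only non-deep bonds, where the double-bar fields agree by tower pinning) and cancel in (97).
[cite: Balaban1985Averaging, (97) p.32, (110) p.34; Balaban1984PropagatorsII, (2.3) p.224] -/
theorem accFrames_quotient_succ_of_not_mem_Om {W U₁ : GaugeField P 0 𝔸ˣ}
    (hidx : ∀ idx : BondIdx D, dbarIterU (idx.1.1 : ℕ) W idx.1.2 = dbarIterU (idx.1.1 : ℕ) U₁ idx.1.2)
    (V : (j : ℕ) → Site P j → 𝔸ˣ) (hVs : ∀ (j : ℕ) (y : Site P (j + 1)), V (j + 1) y = V j (emb y) * vframeU (dbarIterU j W) y)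
    (V₁ : (j : ℕ) → Site P j → 𝔸ˣ) (hV₁s : ∀ (j : ℕ) (y : Site P (j + 1)), V₁ (j + 1) y = V₁ j (emb y) * vframeU (dbarIterU j U₁) y)
    {j : ℕ} (hj : j + 1 ≤ D.k) (y' : Site P (j + 1)) (hy' : y' ∉ D.Om (j + 1)) :
    V₁ (j + 1) y' * (V (j + 1) y')⁻¹ = V₁ j (emb y') * (V j (emb y'))⁻¹ := by
  have hvv : vframeU (dbarIterU j W) y' = vframeU (dbarIterU j U₁) y' := vframeU_dbarIterU_eq_of_not_mem_Om D hidx hj y' hy'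
  rw [hVs, hV₁s, hvv, mul_inv_rev, mul_assoc, mul_inv_cancel_left]

include hcollar in
/-- ★★ **THE FRAME QUOTIENT IS CONSISTENT AT COLLIDING TOUCHED CENTRES** (collar): if an end-point `y` of an index bond of level `j ≤ k` and an end-point `y′` of an index
bond of level `j′ ≤ k` have the same centre, then `V₁_j(y)·V_j(y)⁻¹ = V₁_{j′}(y′)·V_{j′}(y′)⁻¹` — by §0 the collision is `j′ = j` (then `y = y′`) or, up to symmetry,
`(j, emb y′)`-vs-`(j+1, y′)` with `y′ ∉ Ω_{j+1}`, where the previous lemma applies.  The nonlinear twin of p616754 `comb_eq_of_collision`.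
[cite: Balaban1985Averaging, (92) p.31, (97)-(100) p.32, (110) p.34; Balaban1984PropagatorsII, (2.1)-(2.4) p.224] -/
theorem accFrames_quotient_eq_of_collision {W U₁ : GaugeField P 0 𝔸ˣ}
    (hidx : ∀ idx : BondIdx D, dbarIterU (idx.1.1 : ℕ) W idx.1.2 = dbarIterU (idx.1.1 : ℕ) U₁ idx.1.2)
    (V : (j : ℕ) → Site P j → 𝔸ˣ) (hVs : ∀ (j : ℕ) (y : Site P (j + 1)), V (j + 1) y = V j (emb y) * vframeU (dbarIterU j W) y)
    (V₁ : (j : ℕ) → Site P j → 𝔸ˣ) (hV₁s : ∀ (j : ℕ) (y : Site P (j + 1)), V₁ (j + 1) y = V₁ j (emb y) * vframeU (dbarIterU j U₁) y)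
    {j j' : ℕ} {b : PBond P j} {b' : PBond P j'} (hb : D.LamBond j b) (hb' : D.LamBond j' b') {y : Site P j} {y' : Site P j'}
    (hyb : y = b.src ∨ y = b.tgt) (hyb' : y' = b'.src ∨ y' = b'.tgt) (heq : embIter j y = embIter j' y') :
    V₁ j y * (V j y)⁻¹ = V₁ j' y' * (V j' y')⁻¹ := by
  have hjk : j ≤ D.k := D.le_of_lamBond hb
  have hjk' : j' ≤ D.k := D.le_of_lamBond hb'
  rcases lt_trichotomy j j' with hlt | rfl | hgt
  · obtain ⟨hj1, hout⟩ := collision_level D hcollar hb hb' hyb hyb' hlt heq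
    subst hj1
    have hyy' : y = emb y' := eq_emb_of_embIter_eq (hjk.trans D.hk) heq
    rw [hyy', accFrames_quotient_succ_of_not_mem_Om D hidx V hVs V₁ hV₁s hjk' y' hout]
  · have hyy' : y = y' := embIter_injective (hjk.trans D.hk) heq
    rw [hyy']
  · obtain ⟨hj1, hout⟩ := collision_level D hcollar hb' hb hyb' hyb hgt heq.symm
    subst hj1
    have hyy' : y' = emb y := eq_emb_of_embIter_eq (hjk'.trans D.hk) heq.symm
    rw [hyy', accFrames_quotient_succ_of_not_mem_Om D hidx V hVs V₁ hV₁s hjk y hout]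

end Consistency

/-! ## §3  ONE fine gauge map, all levels at once -/

section Gauge

variable (D : Domains P)
  (hcollar : ∀ (i : ℕ) (e : PBond P (i + 1)), D.LamBond (i + 1) e → ∀ z : Site P i, (blockOf z = e.src ∨ blockOf z = e.tgt) → z ∈ D.Om i)

include hcollar in
/-- ★★★ **THE MULTI-LEVEL NONLINEAR ♭ → SINGLE-BAR FIBRE DICTIONARY, FAMILY FORM.**  `D` nested with the collar; `U₁` a fine field with accumulated frames `V₁`; `W t`
(`t : ι`) a family of fine fields, EACH with the double-bar data of `U₁` on the index bonds, with accumulated frames `V t`.  THEN there is ONE family of FINE gauge maps `g t`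
such that (i) at every fine site `x` EITHER `g t x = 1` for all `t` OR there is ONE touched `(j, y)` (`y` an end-point of an index bond of level `j ≤ k`, `embIter j y = x`) with
`g t x = V₁_j(y)·(V t)_j(y)⁻¹` for ALL `t` (a `t`-uniform choice — what the differentiability of `t ↦ g t` along a charted curve reads), and (ii)
`Ū^{(j)}((W t)^{g t})(c) = Ū^{(j)}(U₁)(c)` at EVERY index bond `c` of EVERY level `j ≤ k`, for every `t`: each `W t` is a fine gauge copy of a point of the MULTI-LEVEL
single-bar fibre through `U₁`.  (`g t x` := the frame quotient at ANY touched `(j, y)` over `x` — consistent by §2 — and `1` at untouched sites; then §1.)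
[cite: Balaban1985Averaging, (11) p.19, (92) p.31, (97)-(100) p.32, (110) p.34; Balaban1984PropagatorsII, (2.1)-(2.4) p.224; Balaban1985Variational, (5)-(6) p.278, (156) p.302] -/
theorem exists_fineGauge_family {ι : Type*} (U₁ : GaugeField P 0 𝔸ˣ) (W : ι → GaugeField P 0 𝔸ˣ)
    (hidx : ∀ (t : ι) (idx : BondIdx D), dbarIterU (idx.1.1 : ℕ) (W t) idx.1.2 = dbarIterU (idx.1.1 : ℕ) U₁ idx.1.2)
    (V : ι → (j : ℕ) → Site P j → 𝔸ˣ) (hV0 : ∀ t x, V t 0 x = 1)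
    (hVs : ∀ (t : ι) (j : ℕ) (y : Site P (j + 1)), V t (j + 1) y = V t j (emb y) * vframeU (dbarIterU j (W t)) y)
    (V₁ : (j : ℕ) → Site P j → 𝔸ˣ) (hV₁0 : ∀ x, V₁ 0 x = 1) (hV₁s : ∀ (j : ℕ) (y : Site P (j + 1)), V₁ (j + 1) y = V₁ j (emb y) * vframeU (dbarIterU j U₁) y) :
    ∃ g : ι → GaugeTransf P 0 𝔸ˣ,
      (∀ x : Site P 0, (∀ t, g t x = 1) ∨
        ∃ (j : ℕ) (c : PBond P j) (y : Site P j), j ≤ D.k ∧ D.LamBond j c ∧ (y = c.src ∨ y = c.tgt) ∧ embIter j y = x ∧ ∀ t, g t x = V₁ j y * (V t j y)⁻¹) ∧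
      ∀ (t : ι) (j : ℕ) (c : PBond P j), j ≤ D.k → D.LamBond j c → emlIterU j (gaugeActT (g t) (W t)) c = emlIterU j U₁ c := by
  classical
  -- the touched centres
  let Tc : Site P 0 → Prop := fun x => ∃ (j : ℕ) (c : PBond P j) (y : Site P j), D.LamBond j c ∧ (y = c.src ∨ y = c.tgt) ∧ embIter j y = x
  let g : ι → GaugeTransf P 0 𝔸ˣ := fun t x =>
    if h : Tc x then V₁ h.choose h.choose_spec.choose_spec.choose * (V t h.choose h.choose_spec.choose_spec.choose)⁻¹ else 1
  -- the value at a touched centre is the frame quotient of ANY touched site over it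
  have hgval : ∀ (t : ι) (j : ℕ) (c : PBond P j), D.LamBond j c → ∀ y : Site P j, (y = c.src ∨ y = c.tgt) → g t (embIter j y) = V₁ j y * (V t j y)⁻¹ := by
    intro t j c hc y hy
    have hT : Tc (embIter j y) := ⟨j, c, y, hc, hy, rfl⟩
    have e : g t (embIter j y) = V₁ hT.choose hT.choose_spec.choose_spec.choose * (V t hT.choose hT.choose_spec.choose_spec.choose)⁻¹ := dif_pos hT
    rw [e]
    obtain ⟨hc₀, hy₀, heq₀⟩ := hT.choose_spec.choose_spec.choose_spec
    exact accFrames_quotient_eq_of_collision D hcollar (hidx t) (V t) (hVs t) V₁ hV₁s hc₀ hc hy₀ hy heq₀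
  refine ⟨g, fun x => ?_, fun t j c hj hc => ?_⟩
  · by_cases hT : Tc x
    · obtain ⟨j, c, y, hc, hy, heq⟩ := hT
      exact Or.inr ⟨j, c, y, D.le_of_lamBond hc, hc, hy, heq, fun t => heq ▸ hgval t j c hc y hy⟩
    · exact Or.inl fun t => dif_neg hT
  · exact emlIterU_gaugeActT_eq_of_accFrames D (hidx t) (V t) (hV0 t) (hVs t) V₁ hV₁0 hV₁s (g t) (fun j c _ hc y hy => hgval t j c hc y hy) j c hj hc

include hcollar in
/-- ★★★ **THE MULTI-LEVEL NONLINEAR ♭ → SINGLE-BAR FIBRE DICTIONARY** (one field): `D` nested with the collar, `W`, `U₁` fine fields with EQUAL DOUBLE-BAR DATA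
`U̿^{(j)}W(c) = U̿^{(j)}U₁(c)` on the [B6] (2.3) index bonds.  THEN ONE fine gauge map `g : T_η → 𝔸ˣ` gives `Ū^{(j)}(W^{g})(c) = Ū^{(j)}(U₁)(c)` at EVERY index bond of EVERY
level `j ≤ k` — `W` is a fine gauge copy of a point of NODE 00's multi-level single-bar fibre through `U₁` ([15] (5)–(6): «Ū^j = W_j on Λ_j for every j»).
[cite: Balaban1985Averaging, (11) p.19, (92) p.31, (97)-(100) p.32, (110) p.34; Balaban1984PropagatorsII, (2.1)-(2.4) p.224; Balaban1985Variational, (5)-(6) p.278, (156) p.302] -/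
theorem exists_fineGauge_emlIterU_eq_of_dbarIterU_eq {W U₁ : GaugeField P 0 𝔸ˣ}
    (hidx : ∀ idx : BondIdx D, dbarIterU (idx.1.1 : ℕ) W idx.1.2 = dbarIterU (idx.1.1 : ℕ) U₁ idx.1.2) :
    ∃ g : GaugeTransf P 0 𝔸ˣ, ∀ (j : ℕ) (c : PBond P j), j ≤ D.k → D.LamBond j c → emlIterU j (gaugeActT g W) c = emlIterU j U₁ c := by
  obtain ⟨V, hV0, hVs, -⟩ := exists_accFrames_dbarIterU (P := P) W
  obtain ⟨V₁, hV₁0, hV₁s, -⟩ := exists_accFrames_dbarIterU (P := P) U₁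
  obtain ⟨g, -, hg⟩ := exists_fineGauge_family D hcollar U₁ (fun _ : Unit => W) (fun _ => hidx) (fun _ => V) (fun _ => hV0) (fun _ => hVs) V₁ hV₁0 hV₁s
  exact ⟨g (), hg ()⟩

end Gauge

/-! ## §4  The gauge map in a multiplicative predicate («unitary, det = 1» at the knit) -/

section Pred

variable (D : Domains P)
  (hcollar : ∀ (i : ℕ) (e : PBond P (i + 1)), D.LamBond (i + 1) e → ∀ z : Site P i, (blockOf z = e.src ∨ blockOf z = e.tgt) → z ∈ D.Om i)
  (p : 𝔸ˣ → Prop)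

include hcollar in
/-- ★★ **FAMILY FORM WITH VALUES IN `p`**: under UST's small-readable-blocks hypotheses for `U₁` and every `W t` (an `emb`-closed family `Sm ⊇ Ω` of blocks on which the
block frames of the towers satisfy the multiplicative inverse-closed predicate `p`), the fine gauge maps of `exists_fineGauge_family` take values in `p` at EVERY site
(✓`HalvingCompetitorMapFrames.accFrames_quotient_pred` at the touched centres, `p 1` elsewhere). [cite: Balaban1985Averaging, (92) p.31, (97)-(100) p.32, (110) p.34; Balaban1984PropagatorsII, (2.1)-(2.4) p.224] -/
theorem exists_fineGauge_pred_family (h1 : p 1) (hmul : ∀ a b, p a → p b → p (a * b)) (hinv : ∀ a, p a → p a⁻¹)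
    {ι : Type*} (U₁ : GaugeField P 0 𝔸ˣ) (W : ι → GaugeField P 0 𝔸ˣ)
    (hidx : ∀ (t : ι) (idx : BondIdx D), dbarIterU (idx.1.1 : ℕ) (W t) idx.1.2 = dbarIterU (idx.1.1 : ℕ) U₁ idx.1.2)
    (V : ι → (j : ℕ) → Site P j → 𝔸ˣ) (hV0 : ∀ t x, V t 0 x = 1)
    (hVs : ∀ (t : ι) (j : ℕ) (y : Site P (j + 1)), V t (j + 1) y = V t j (emb y) * vframeU (dbarIterU j (W t)) y)
    (V₁ : (j : ℕ) → Site P j → 𝔸ˣ) (hV₁0 : ∀ x, V₁ 0 x = 1) (hV₁s : ∀ (j : ℕ) (y : Site P (j + 1)), V₁ (j + 1) y = V₁ j (emb y) * vframeU (dbarIterU j U₁) y)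
    (Sm : (j : ℕ) → Set (Site P j)) (hemb : ∀ (j : ℕ) (z : Site P (j + 1)), z ∈ Sm (j + 1) → emb z ∈ Sm j)
    (hΩ : ∀ (j : ℕ) (y : Site P (j + 1)), j + 1 ≤ D.k → y ∈ D.Om (j + 1) → y ∈ Sm (j + 1))
    (hvf₁ : ∀ (j : ℕ) (z : Site P (j + 1)), z ∈ Sm (j + 1) → p (vframeU (dbarIterU j U₁) z))
    (hvf : ∀ (t : ι) (j : ℕ) (z : Site P (j + 1)), z ∈ Sm (j + 1) → p (vframeU (dbarIterU j (W t)) z)) :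
    ∃ g : ι → GaugeTransf P 0 𝔸ˣ, (∀ t x, p (g t x)) ∧
      (∀ x : Site P 0, (∀ t, g t x = 1) ∨
        ∃ (j : ℕ) (c : PBond P j) (y : Site P j), j ≤ D.k ∧ D.LamBond j c ∧ (y = c.src ∨ y = c.tgt) ∧ embIter j y = x ∧ ∀ t, g t x = V₁ j y * (V t j y)⁻¹) ∧
      ∀ (t : ι) (j : ℕ) (c : PBond P j), j ≤ D.k → D.LamBond j c → emlIterU j (gaugeActT (g t) (W t)) c = emlIterU j U₁ c := by
  obtain ⟨g, hch, hg⟩ := exists_fineGauge_family D hcollar U₁ W hidx V hV0 hVs V₁ hV₁0 hV₁s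
  refine ⟨g, fun t x => ?_, hch, hg⟩
  rcases hch x with h | ⟨j, c, y, hj, -, -, -, hval⟩
  · rw [h t]; exact h1
  · rw [hval t]
    exact accFrames_quotient_pred D p h1 hmul hinv (fun idx => (hidx t idx).symm) V₁ hV₁0 hV₁s (V t) (hV0 t) (hVs t) Sm hemb hΩ hvf₁ (hvf t) j hj y

include hcollar in
/-- ★★ **ONE FIELD, VALUES IN `p`**: equal double-bar data on the index bonds + the small-readable-blocks hypotheses ⇒ a fine gauge map with values in `p` at every site carrying
`W` onto the single-bar data of `U₁` at every index bond of every level. [cite: Balaban1985Averaging, (92) p.31, (97)-(100) p.32, (110) p.34; Balaban1984PropagatorsII, (2.1)-(2.4) p.224; Balaban1985Variational, (5)-(6) p.278] -/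
theorem exists_fineGauge_pred_emlIterU_eq (h1 : p 1) (hmul : ∀ a b, p a → p b → p (a * b)) (hinv : ∀ a, p a → p a⁻¹)
    {W U₁ : GaugeField P 0 𝔸ˣ} (hidx : ∀ idx : BondIdx D, dbarIterU (idx.1.1 : ℕ) W idx.1.2 = dbarIterU (idx.1.1 : ℕ) U₁ idx.1.2)
    (Sm : (j : ℕ) → Set (Site P j)) (hemb : ∀ (j : ℕ) (z : Site P (j + 1)), z ∈ Sm (j + 1) → emb z ∈ Sm j)
    (hΩ : ∀ (j : ℕ) (y : Site P (j + 1)), j + 1 ≤ D.k → y ∈ D.Om (j + 1) → y ∈ Sm (j + 1))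
    (hvf₁ : ∀ (j : ℕ) (z : Site P (j + 1)), z ∈ Sm (j + 1) → p (vframeU (dbarIterU j U₁) z))
    (hvf : ∀ (j : ℕ) (z : Site P (j + 1)), z ∈ Sm (j + 1) → p (vframeU (dbarIterU j W) z)) :
    ∃ g : GaugeTransf P 0 𝔸ˣ, (∀ x, p (g x)) ∧ ∀ (j : ℕ) (c : PBond P j), j ≤ D.k → D.LamBond j c → emlIterU j (gaugeActT g W) c = emlIterU j U₁ c := by
  obtain ⟨V, hV0, hVs, -⟩ := exists_accFrames_dbarIterU (P := P) W
  obtain ⟨V₁, hV₁0, hV₁s, -⟩ := exists_accFrames_dbarIterU (P := P) U₁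
  obtain ⟨g, hp, -, hg⟩ := exists_fineGauge_pred_family D hcollar p h1 hmul hinv U₁ (fun _ : Unit => W) (fun _ => hidx) (fun _ => V) (fun _ => hV0) (fun _ => hVs)
    V₁ hV₁0 hV₁s Sm hemb hΩ hvf₁ (fun _ => hvf)
  exact ⟨g (), hp (), hg ()⟩

end Pred

/-! ## §5  Target a gauge copy `U₁ = (U₀)^{u}` -/

section Copy

variable (D : Domains P)
  (hcollar : ∀ (i : ℕ) (e : PBond P (i + 1)), D.LamBond (i + 1) e → ∀ z : Site P i, (blockOf z = e.src ∨ blockOf z = e.tgt) → z ∈ D.Om i)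

/-- Undoing a fine gauge copy on the single-bar data: `Ū^{(j)}((X)^{u⁻¹})(c) = Ū^{(j)}(U₀)(c)` whenever `Ū^{(j)}X(c) = Ū^{(j)}(U₀^{u})(c)` (covariance (11) twice).
[cite: Balaban1985Averaging, (11) p.19] -/
theorem emlIterU_gaugeActT_inv_eq {X U₀ : GaugeField P 0 𝔸ˣ} (u : GaugeTransf P 0 𝔸ˣ) {j : ℕ} {c : PBond P j}
    (h : emlIterU j X c = emlIterU j (gaugeActT u U₀) c) :
    emlIterU j (gaugeActT (fun x => (u x)⁻¹) X) c = emlIterU j U₀ c := by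
  rw [emlIterU_gaugeActT_fine, gaugeActT_apply, h, emlIterU_gaugeActT_fine, gaugeActT_apply]
  simp only [inv_inv, mul_assoc, inv_mul_cancel_left, inv_mul_cancel, mul_one]

include hcollar in
/-- ★ **TARGET A GAUGE COPY**: if every `W t` has the double-bar data of `U₁ = (U₀)^{u}` on the index bonds (at the knit: `U₀` the record's minimiser, `u` its Landau∕axial
re-gauging, `U₁ = e^{iηA₁}`), some family of fine gauge maps carries each `W t` onto the single-bar data OF `U₀` at every index bond of every level — i.e. INTO the fibre on which
the record is critical. [cite: Balaban1985Averaging, (11) p.19, (92) p.31, (97)-(100) p.32; Balaban1985Variational, (5)-(6) p.278, (152)-(153) p.301, (156) p.302] -/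
theorem exists_fineGauge_emlIterU_eq_of_dbarIterU_eq_gaugeActT {ι : Type*} (U₀ : GaugeField P 0 𝔸ˣ) (u : GaugeTransf P 0 𝔸ˣ) (W : ι → GaugeField P 0 𝔸ˣ)
    (hidx : ∀ (t : ι) (idx : BondIdx D), dbarIterU (idx.1.1 : ℕ) (W t) idx.1.2 = dbarIterU (idx.1.1 : ℕ) (gaugeActT u U₀) idx.1.2) :
    ∃ g : ι → GaugeTransf P 0 𝔸ˣ, ∀ (t : ι) (j : ℕ) (c : PBond P j), j ≤ D.k → D.LamBond j c → emlIterU j (gaugeActT (g t) (W t)) c = emlIterU j U₀ c := by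
  choose V hV0 hVs _ using fun t => exists_accFrames_dbarIterU (P := P) (W t)
  obtain ⟨V₁, hV₁0, hV₁s, -⟩ := exists_accFrames_dbarIterU (P := P) (gaugeActT u U₀)
  obtain ⟨g, -, hg⟩ := exists_fineGauge_family D hcollar (gaugeActT u U₀) W hidx V hV0 hVs V₁ hV₁0 hV₁s
  refine ⟨fun t x => (u x)⁻¹ * g t x, fun t j c hj hc => ?_⟩
  have e : gaugeActT (fun x => (u x)⁻¹ * g t x) (W t) = gaugeActT (fun x => (u x)⁻¹) (gaugeActT (g t) (W t)) := by rw [gaugeActT_gaugeActT]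
  rw [e]
  exact emlIterU_gaugeActT_inv_eq u (hg t j c hj hc)

end Copy

end Summit.QuantumFields.YangMills.Theorems.K0Stub1DoubleBarFibreDictionary

end
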